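import Summits.QuantumFields.BalabanUV.T4Continuum.Support.NE7K1LinWalkSmallness

/-!
# NE7K1LinWalkExpansion — row NE7 (node U5), candidate route HOM, path H1L, cell K1-lin(s): THE CONVERGENT RANDOM-WALK EXPANSION
# (2.12)–(2.13) AND THE DECAY (2.22)∕(2.30) FOR AN ABSTRACT FINITE-RANGE COERCIVE MATRIX — `B4RandomWalk213` CONSUMED BY NAME with its
# inputs PROVED (files 1–2): `‖R‖ < 1 ⇒ P⁻¹ = Σ_n G₀Rⁿ`, and `|P⁻¹(x,y)| ≤ C·(3^ν τ)^{N−1}` across `N` cube steps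

Lineage `b2b-balaban-t4-ne7-p2` (CRUX PROVER NE7 #2), generation 68; series (RW) file 3 (operator-norm packaging).  Over
`NE7K1LinWalkParametrix` (identity `P·G₀ = 1 − R`, locality) and `NE7K1LinWalkSmallness` (vector-level L² bounds), in the `ℓ²`-OPERATOR
NORM of Mathlib (`open scoped Matrix.Norms.L2Operator`: `Matrix.instL2OpNormedRing`, the C⋆-norm of matrices acting on
`EuclideanSpace ℝ ι`):

* `l2_opNorm_le_of_mulVec_sq_le` — `(∀ v, ‖Av‖² ≤ c²‖v‖²) ⇒ ‖A‖ ≤ c`; `abs_entry_le_l2_opNorm` — `|A x y| ≤ ‖A‖`;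
  `l2_opNorm_ind_le_one`; `ind_mul_mul_ind_apply` (`(1_{x}·A·1_{y})_{xy} = A_{xy}`).
* `l2_opNorm_aPiece_le` (`Λ∕min(σ,1)`), `l2_opNorm_bPiece_le` (`√τ²`), **`l2_opNorm_remainder_le`** (`‖R‖ ≤ √(m·m̃·τ²)`) — B4 p. 577.
* **`hasSum_walk_expansion`** — `‖R‖ < 1 ⇒ HasSum (n ↦ G₀Rⁿ) P⁻¹`: B4 (2.12) *"G_k(Ω,A) = G₀(I − R)^{−1} = Σ_{n=0}^∞ G₀R^n … the series
  in the representation (2.12) is convergent in this norm"* — an OUTPUT here (`B4RandomWalk213.hasSum_of_norm_lt_one` BY NAME on the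
  PROVED identity `P⁻¹(1 − R) = G₀`), where `B4RandomWalk213` had to take it as the input `hG`.
* **`inv_entry_decay`** — THE (2.22)∕(2.30)-SHAPE DECAY OF THE INVERSE: with cut-off regions labelled injectively in `ℤ^ν` so that
  regions with non-adjacent labels (`¬ B4RandomWalk213.cubeAdj`) are disjoint, `|P⁻¹(x,y)| ≤ m₀·(Λ∕min(σ,1))·τ·3^ν·(3^ν τ)^{N−1}∕(1 − 3^ν τ)`
  whenever every label carrying `x` (through `l_j(x) ≠ 0`) is `≥ N ≥ 1` label-steps (sup-distance) from every label carrying `y`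
  (through `r_k(y) ≠ 0`) and `3^ν τ < 1`, `τ = √(α²∕min(σ,1) + β²∕min(σ,1)²)` — `B4RandomWalk213.lattice_walk_decay_bound` BY NAME, ALL of
  its hypotheses (`hG`, `hab`, `hbb`, `hP`, `hP'a`, `hP'b`, `hα`, `hβ`, `hβ₁`) DISCHARGED from files 1–2.

HONEST FRAMING: [folklore] finite linear algebra + the tree's B4 bookkeeping; ONE scale (regions of a fixed size on the given index
set; no multi-scale factor `M^{−½|ω|}`, no Hölder norms of B4 §3); (H-comm) and the region geometry are hypotheses here (files 4–5
instantiate them at A = 0); nothing of Bałaban's asserted; no `sorry`.  Census only; NO letter ∕ tag ∕ size of NE7 moves; NE7 NOT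
PRINTED ∕ NOT PROVED; spine 0∕9; FIXED FINITE T⁴, rung (B)+1; NOT infinite volume, NOT mass gap, NOT Clay.  HONEST DEPENDENCY:
continuum YM on T⁴ ⇐ BetaPertH ∧ nine spine estimates (0/9 proved); BetaPertH ⇐ (D1) ∧ (D4) ∧ CAP+tail; G-an2-4 gates asym, D1 and
NE2/3/4.
-/

noncomputable section

open Finset Matrix WithLp
open scoped Matrix.Norms.L2Operator

namespace Summit.QuantumFields.BalabanUV.T4Continuum.NE7K1LinWalkExpansion

open NE7K1LinSchurLineForm NE7K1LinSchurLineDerivRel NE7K1LinInvAntitone NE7K1LinWalkParametrix NE7K1LinWalkSmallness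
open Literature.MathematicalPhysics.QuantumFieldTheory.Balaban1983to89

variable {ι : Type*} [Fintype ι] [DecidableEq ι]

/-! ### §1 `ℓ²`-operator norm from vector bounds; entries -/

omit [DecidableEq ι] in
/-- `‖w‖² = w·w` for `w : EuclideanSpace ℝ ι` (in `ofLp` coordinates). [folklore] -/
theorem norm_sq_eq_dot (w : EuclideanSpace ℝ ι) : ‖w‖ ^ 2 = ofLp w ⬝ᵥ ofLp w := by
  rw [← real_inner_self_eq_norm_sq, EuclideanSpace.inner_eq_star_dotProduct, star_trivial]

/-- **VECTOR BOUND ⇒ OPERATOR-NORM BOUND**: `(∀ v, ‖Av‖² ≤ c²‖v‖²) ⇒ ‖A‖ ≤ c` in the `ℓ²`-operator norm. [folklore] -/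
theorem l2_opNorm_le_of_mulVec_sq_le (A : Matrix ι ι ℝ) {c : ℝ} (hc : 0 ≤ c)
    (h : ∀ v : ι → ℝ, A *ᵥ v ⬝ᵥ A *ᵥ v ≤ c ^ 2 * (v ⬝ᵥ v)) : ‖A‖ ≤ c := by
  rw [Matrix.cstar_norm_def]
  refine ContinuousLinearMap.opNorm_le_bound _ hc fun w => ?_
  have h1 : ‖Matrix.toEuclideanCLM (n := ι) (𝕜 := ℝ) A w‖ ^ 2 ≤ (c * ‖w‖) ^ 2 := by
    rw [norm_sq_eq_dot, Matrix.ofLp_toEuclideanCLM, mul_pow, norm_sq_eq_dot]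
    exact h _
  exact (pow_le_pow_iff_left₀ (norm_nonneg _) (mul_nonneg hc (norm_nonneg _)) two_ne_zero).mp h1

/-- **ENTRIES ARE BOUNDED BY THE OPERATOR NORM**: `|A x y| ≤ ‖A‖`. [folklore] -/
theorem abs_entry_le_l2_opNorm (A : Matrix ι ι ℝ) (x y : ι) : |A x y| ≤ ‖A‖ := by
  set e : EuclideanSpace ℝ ι := EuclideanSpace.single y (1 : ℝ) with he
  have hAe := Matrix.l2_opNorm_mulVec A e
  have hnorm_e : ‖e‖ = 1 := by simp [he]
  rw [hnorm_e, mul_one] at hAe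
  have hcomp : ‖((EuclideanSpace.equiv ι ℝ).symm (A *ᵥ ofLp e)) x‖ ≤ ‖(EuclideanSpace.equiv ι ℝ).symm (A *ᵥ ofLp e)‖ :=
    PiLp.norm_apply_le _ x
  have hentry : ((EuclideanSpace.equiv ι ℝ).symm (A *ᵥ ofLp e)) x = A x y := by
    simp [he, EuclideanSpace.single]
  rw [hentry, Real.norm_eq_abs] at hcomp
  exact hcomp.trans hAe

/-- the indicator diagonal is a contraction: `‖1_A‖ ≤ 1`. [folklore] -/
theorem l2_opNorm_ind_le_one (A : Finset ι) : ‖ind A‖ ≤ 1 := by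
  refine l2_opNorm_le_of_mulVec_sq_le _ zero_le_one fun v => ?_
  rw [one_pow, one_mul]
  refine Finset.sum_le_sum fun x _ => ?_
  rw [ind, mulVec_diagonal]
  by_cases hx : x ∈ A <;> simp [hx, mul_self_nonneg]

/-- `(1_{x}·A·1_{y})_{xy} = A_{xy}`. [folklore] -/
theorem ind_mul_mul_ind_apply (A : Matrix ι ι ℝ) (x y : ι) : (ind {x} * A * ind {y}) x y = A x y := by
  simp [ind, Matrix.mul_apply, diagonal, Finset.mem_singleton]

/-! ### §2 Operator-norm bounds of the pieces and of the remainder -/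

/-- `‖a_j‖ ≤ Λ∕min(σ,1)`. [cite: Balaban1983RegularityDecay, Lemma 2.1 (2.15) p.577, shape] [folklore] -/
theorem l2_opNorm_aPiece_le (P : Matrix ι ι ℝ) {σ : ℝ} (hσ : 0 < σ) (hPc : ∀ w, σ * (w ⬝ᵥ w) ≤ w ⬝ᵥ P *ᵥ w) {l r : ι → ℝ}
    {Λ : ℝ} (hΛ : 0 ≤ Λ) (hl : ∀ x, |l x| ≤ Λ) (hr : ∀ x, |r x| ≤ 1) (S : Finset ι) :
    ‖aPiece P l r S‖ ≤ Λ / min σ 1 := by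
  have hσ' : 0 < min σ 1 := lt_min hσ one_pos
  refine l2_opNorm_le_of_mulVec_sq_le _ (div_nonneg hΛ hσ'.le) fun v => ?_
  rw [div_pow]
  exact aPiece_mulVec_sq_le P hσ hPc hl hr S v

/-- `‖b_j‖ ≤ τ := √(α²∕min(σ,1) + β²∕min(σ,1)²)` under (H-comm). [cite: Balaban1983RegularityDecay, (2.11) p.576 + (2.15) p.577, shape] [folklore] -/
theorem l2_opNorm_bPiece_le (P : Matrix ι ι ℝ) {σ : ℝ} (hσ : 0 < σ) (hPc : ∀ w, σ * (w ⬝ᵥ w) ≤ w ⬝ᵥ P *ᵥ w) {l r : ι → ℝ}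
    {S : Finset ι} (hr : ∀ x, r x ≠ 0 → x ∈ S) (hr1 : ∀ x, |r x| ≤ 1) {α2 β2 : ℝ} (hα : 0 ≤ α2) (hβ : 0 ≤ β2)
    (hcomm : ∀ v, comm l P *ᵥ v ⬝ᵥ comm l P *ᵥ v ≤ α2 * (v ⬝ᵥ P *ᵥ v) + β2 * (v ⬝ᵥ v)) :
    ‖bPiece P l r S‖ ≤ Real.sqrt (α2 / min σ 1 + β2 / (min σ 1) ^ 2) := by
  have hσ' : 0 < min σ 1 := lt_min hσ one_pos
  refine l2_opNorm_le_of_mulVec_sq_le _ (Real.sqrt_nonneg _) fun v => ?_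
  rw [Real.sq_sqrt (by positivity)]
  exact bPiece_mulVec_sq_le' P hσ hPc hr hr1 hα hβ hcomm v

/-- **B4 p. 577 IN OPERATOR NORM**: `‖R‖ ≤ √(m·m̃·τ²)` for `R = Σ_j [diag(l_j),P]·G_j·diag(r_j)`, independently of the number of
regions. [cite: Balaban1983RegularityDecay, p.577 after (2.12)] [folklore] -/
theorem l2_opNorm_remainder_le {J : Type*} [Fintype J] [DecidableEq J] (P : Matrix ι ι ℝ) {σ : ℝ} (hσ : 0 < σ)
    (hPc : ∀ w, σ * (w ⬝ᵥ w) ≤ w ⬝ᵥ P *ᵥ w) (l r : J → ι → ℝ) (S : J → Finset ι)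
    (hcut : ∀ j, CutoffOn P (l j) (S j)) (hr : ∀ j x, r j x ≠ 0 → x ∈ S j) (hr1 : ∀ j x, |r j x| ≤ 1)
    {α2 β2 : ℝ} (hα : 0 ≤ α2) (hβ : 0 ≤ β2)
    (hcomm : ∀ j v, comm (l j) P *ᵥ v ⬝ᵥ comm (l j) P *ᵥ v ≤ α2 * (v ⬝ᵥ P *ᵥ v) + β2 * (v ⬝ᵥ v))
    {m mt : ℕ} (hm : ∀ j, (univ.filter fun k => ¬ Disjoint (S j) (S k)).card ≤ m)
    (hcover : ∀ x, (univ.filter fun j => r j x ≠ 0).card ≤ mt) :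
    ‖∑ j, bPiece P (l j) (r j) (S j)‖ ≤ Real.sqrt (m * mt * (α2 / min σ 1 + β2 / (min σ 1) ^ 2)) := by
  have hσ' : 0 < min σ 1 := lt_min hσ one_pos
  refine l2_opNorm_le_of_mulVec_sq_le _ (Real.sqrt_nonneg _) fun v => ?_
  rw [Real.sq_sqrt (by positivity)]
  exact remainder_mulVec_sq_le P hσ hPc l r S hcut hr hr1 hα hβ hcomm hm hcover v

/-! ### §3 The convergent expansion (2.12) and the decay (2.22)∕(2.30) -/

/-- **B4 (2.12) AS AN OUTPUT**: if `‖R‖ < 1` then `P⁻¹ = Σ_{n≥0} G₀Rⁿ` as a convergent series in the `ℓ²`-operator norm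
(`B4RandomWalk213.hasSum_of_norm_lt_one` on the proved identity `P⁻¹(1 − R) = G₀`). [cite: Balaban1983RegularityDecay, (2.12) p.577] [folklore] -/
theorem hasSum_walk_expansion {J : Type*} [Fintype J] (P : Matrix ι ι ℝ) {σ : ℝ} (hσ : 0 < σ)
    (hPc : ∀ w, σ * (w ⬝ᵥ w) ≤ w ⬝ᵥ P *ᵥ w) (l r : J → ι → ℝ) (S : J → Finset ι)
    (hcut : ∀ j, CutoffOn P (l j) (S j)) (hpu : ∀ x, ∑ j, l j x * r j x = 1)
    (hR : ‖∑ j, bPiece P (l j) (r j) (S j)‖ < 1) :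
    HasSum (fun n : ℕ => (∑ j, aPiece P (l j) (r j) (S j)) * (∑ j, bPiece P (l j) (r j) (S j)) ^ n) P⁻¹ :=
  haveI : CompleteSpace (Matrix ι ι ℝ) := FiniteDimensional.complete ℝ (Matrix ι ι ℝ)
  B4RandomWalk213.hasSum_of_norm_lt_one hR (inv_mul_one_sub_eq P hσ hPc l r S hcut hpu)

/-- **THE DECAY OF THE INVERSE ACROSS CUBE STEPS — (2.22)∕(2.30) FOR AN ABSTRACT FINITE-RANGE COERCIVE MATRIX.**  Data: `P`
`σ`-coercive; cut-off triples `(l_j, r_j, S_j)` indexed by a finite `J` with labels `pos : J → ℤ^ν` (injective) such that regions with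
NON-ADJACENT labels are DISJOINT; `l_j` lives on `S_j` for `P`, `Σ_j l_j r_j ≡ 1`, `|l_j| ≤ Λ`, `supp r_j ⊆ S_j`, `|r_j| ≤ 1`; (H-comm)
with `(α², β²)`; at most `m₀` of the `l_j` nonzero at `x`.  If `3^ν·τ < 1` (`τ = √(α²∕min(σ,1) + β²∕min(σ,1)²)`), `‖R‖ < 1`, and every
label carrying `x` is `≥ N ≥ 1` sup-distance steps from every label carrying `y`, then
`|P⁻¹(x,y)| ≤ m₀·(Λ∕min(σ,1))·τ·3^ν·(3^ν τ)^{N−1}∕(1 − 3^ν τ)` — `B4RandomWalk213.lattice_walk_decay_bound` BY NAME with every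
hypothesis discharged. [cite: Balaban1983RegularityDecay, (2.22) p.579, Corollary 2.3 (2.30) pp.580–581] [folklore] -/
theorem inv_entry_decay {J : Type*} [Fintype J] [DecidableEq J] {ν : ℕ} (pos : J → Fin ν → ℤ)
    (hpos : Function.Injective pos) (P : Matrix ι ι ℝ) {σ : ℝ} (hσ : 0 < σ)
    (hPc : ∀ w, σ * (w ⬝ᵥ w) ≤ w ⬝ᵥ P *ᵥ w) (l r : J → ι → ℝ) (S : J → Finset ι)
    (hdisj : ∀ j k, ¬ B4RandomWalk213.cubeAdj pos j k → Disjoint (S j) (S k))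
    (hcut : ∀ j, CutoffOn P (l j) (S j)) (hpu : ∀ x, ∑ j, l j x * r j x = 1)
    {Λ : ℝ} (hΛ : 0 ≤ Λ) (hl : ∀ j x, |l j x| ≤ Λ) (hr : ∀ j x, r j x ≠ 0 → x ∈ S j) (hr1 : ∀ j x, |r j x| ≤ 1)
    {α2 β2 : ℝ} (hα : 0 ≤ α2) (hβ : 0 ≤ β2)
    (hcomm : ∀ j v, comm (l j) P *ᵥ v ⬝ᵥ comm (l j) P *ᵥ v ≤ α2 * (v ⬝ᵥ P *ᵥ v) + β2 * (v ⬝ᵥ v))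
    (hsmall : (3 : ℝ) ^ ν * Real.sqrt (α2 / min σ 1 + β2 / (min σ 1) ^ 2) < 1)
    (hR : ‖∑ j, bPiece P (l j) (r j) (S j)‖ < 1)
    {m₀ : ℕ} (x y : ι) (hm₀ : (univ.filter fun j => l j x ≠ 0).card ≤ m₀) {N : ℕ} (hN : 1 ≤ N)
    (hsep : ∀ j, l j x ≠ 0 → ∀ k, r k y ≠ 0 → ∃ μ, (N : ℤ) ≤ |pos j μ - pos k μ|) :
    |P⁻¹ x y| ≤ m₀ * (Λ / min σ 1) * Real.sqrt (α2 / min σ 1 + β2 / (min σ 1) ^ 2) * (3 : ℝ) ^ ν *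
      ((3 : ℝ) ^ ν * Real.sqrt (α2 / min σ 1 + β2 / (min σ 1) ^ 2)) ^ (N - 1) /
        (1 - (3 : ℝ) ^ ν * Real.sqrt (α2 / min σ 1 + β2 / (min σ 1) ^ 2)) := by
  classical
  have hσ' : 0 < min σ 1 := lt_min hσ one_pos
  set τ := Real.sqrt (α2 / min σ 1 + β2 / (min σ 1) ^ 2) with hτ
  have hτ0 : 0 ≤ τ := Real.sqrt_nonneg _
  set a : J → Matrix ι ι ℝ := fun j => aPiece P (l j) (r j) (S j) with ha
  set b : J → Matrix ι ι ℝ := fun j => bPiece P (l j) (r j) (S j) with hb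
  set S₀ : Finset J := univ.filter fun j => l j x ≠ 0 with hS₀
  set S₁ : Finset J := univ.filter fun j => r j y ≠ 0 with hS₁
  -- the hypotheses of `lattice_walk_decay_bound`, one by one
  have hG : HasSum (fun n : ℕ => (∑ j, a j) * (∑ j, b j) ^ n) P⁻¹ := hasSum_walk_expansion P hσ hPc l r S hcut hpu hR
  have hab : ∀ i k, ¬ B4RandomWalk213.cubeAdj pos i k → a i * b k = 0 := fun i k hik =>
    aPiece_mul_bPiece P (hr i) (hcut k) (hdisj i k hik)
  have hbb : ∀ i k, ¬ B4RandomWalk213.cubeAdj pos i k → b i * b k = 0 := fun i k hik =>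
    bPiece_mul_bPiece P (hr i) (hcut k) (hdisj i k hik)
  have hPcut : ∀ i ∉ S₀, ind {x} * a i = 0 := fun i hi =>
    (piece_cutoffs P (A := {x}) (B := ∅) (fun z hz => by
        rw [Finset.mem_singleton] at hz; subst hz
        by_contra h; exact hi (Finset.mem_filter.mpr ⟨Finset.mem_univ _, h⟩))
      (fun z hz => absurd hz (Finset.notMem_empty z))).1
  have hrB : ∀ i ∉ S₁, ∀ z, z ∈ ({y} : Finset ι) → r i z = 0 := fun i hi z hz => by
    rw [Finset.mem_singleton] at hz; subst hz
    by_contra h; exact hi (Finset.mem_filter.mpr ⟨Finset.mem_univ _, h⟩)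
  have hP'a : ∀ i ∉ S₁, a i * ind {y} = 0 := fun i hi =>
    (piece_cutoffs P (A := ∅) (fun z hz => absurd hz (Finset.notMem_empty z)) (hrB i hi)).2.1
  have hP'b : ∀ i ∉ S₁, b i * ind {y} = 0 := fun i hi =>
    (piece_cutoffs P (A := ∅) (fun z hz => absurd hz (Finset.notMem_empty z)) (hrB i hi)).2.2
  have hαw : ∀ i, ‖ind {x} * a i‖ ≤ Λ / min σ 1 := fun i =>
    (Matrix.l2_opNorm_mul _ _).trans <| by
      have h1 := l2_opNorm_ind_le_one (ι := ι) {x}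
      have h2 := l2_opNorm_aPiece_le P hσ hPc hΛ (hl i) (hr1 i) (S i)
      have h3 : 0 ≤ ‖a i‖ := norm_nonneg _
      nlinarith
  have hβw : ∀ i, ‖b i‖ ≤ τ := fun i => l2_opNorm_bPiece_le P hσ hPc (hr i) (hr1 i) hα hβ (hcomm i)
  have hβ₁ : ∀ i, ‖b i * ind {y}‖ ≤ τ := fun i =>
    (Matrix.l2_opNorm_mul _ _).trans <| by
      have h1 := l2_opNorm_ind_le_one (ι := ι) {y}
      have h2 := hβw i
      have h3 : 0 ≤ ‖ind ({y} : Finset ι)‖ := norm_nonneg _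
      nlinarith
  have hsep' : ∀ i ∈ S₀, ∀ k ∈ S₁, ∃ μ, (N : ℤ) ≤ |pos i μ - pos k μ| := fun i hi k hk =>
    hsep i (Finset.mem_filter.mp hi).2 k (Finset.mem_filter.mp hk).2
  have hmain := B4RandomWalk213.lattice_walk_decay_bound pos hpos (a := a) (b := b) (G := P⁻¹) rfl rfl hG hab hbb hPcut hP'a
    hP'b hαw hτ0 hβw hβ₁ hsmall hN hsep'
  -- read off the entry
  have hent : |P⁻¹ x y| ≤ ‖ind {x} * P⁻¹ * ind {y}‖ := by
    rw [← ind_mul_mul_ind_apply P⁻¹ x y]; exact abs_entry_le_l2_opNorm _ x y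
  refine hent.trans (hmain.trans ?_)
  have hden : 0 < 1 - (3 : ℝ) ^ ν * τ := by linarith
  have hnum : 0 ≤ Λ / min σ 1 * τ * (3 : ℝ) ^ ν * ((3 : ℝ) ^ ν * τ) ^ (N - 1) := by positivity
  have hcard : (S₀.card : ℝ) ≤ m₀ := by exact_mod_cast hm₀
  rw [div_le_div_iff_of_pos_right hden]
  calc (S₀.card : ℝ) * (Λ / min σ 1) * τ * (3 : ℝ) ^ ν * ((3 : ℝ) ^ ν * τ) ^ (N - 1)
      = S₀.card * (Λ / min σ 1 * τ * (3 : ℝ) ^ ν * ((3 : ℝ) ^ ν * τ) ^ (N - 1)) := by ring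
    _ ≤ m₀ * (Λ / min σ 1 * τ * (3 : ℝ) ^ ν * ((3 : ℝ) ^ ν * τ) ^ (N - 1)) := mul_le_mul_of_nonneg_right hcard hnum
    _ = m₀ * (Λ / min σ 1) * τ * (3 : ℝ) ^ ν * ((3 : ℝ) ^ ν * τ) ^ (N - 1) := by ring

end Summit.QuantumFields.BalabanUV.T4Continuum.NE7K1LinWalkExpansion

end
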